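import Mathlib
import HarnessLib
import Summits.MatrixMultiplication.MatrixMultiplication.Theorems.OutsiderSandwichCwCubeSubrank

/-!
# Cap sets lift to free diagonals of `cw₂^{⊠N}`: `Q_ℂ(cw₂^{⊠N}) ≥ 3^{N−k} · |Λ|` for every cap `Λ ⊂ 𝔽₃^k`, `k ≤ N ≤ 2k`

Helper file for `LaserTangency` (route OutsiderSandwich, item `stmt-MatrixMultiplication-32268`),
K41 of the `decomp-mm` lens «minimal counterexample / extremal reduction»: the STRUCTURE of the
extremal zeroing-out diagonals behind the packing census of `cw₂^{⊠N}` (NODE-g37 … g40;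
`OutsiderSandwichCwCubeSubrank`, `OutsiderSandwichPackFloors`, `OutsiderSandwichHammingBound`),
and the new floors it produces.  Throughout `D a b c = [a, b, c pairwise distinct]` on `Fin 3`
(given as a schema `hD`, as in `OutsiderSandwichCwCubeSubrank`, whose `cw₂ ≥ D` over `ℂ` is the only
import used beyond `Literature`), and `𝔽₃ = Fin 3` with its ring structure.

1. **AP normal form** (`kroneckerPow_diag_ne_zero_iff`, `diag_eq_lineIndicator_sub_unit`):
   `D = 𝟙[a + b + c = 0] − 𝟙[a = b = c]` (the cap-set tensor of `𝔽₃` minus the unit tensor), and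
   `supp(D^{⊠N}) = {(x, x − d, x + d) : x ∈ 𝔽₃^N, d ∈ {1,2}^N}` — the three-term progressions of
   `𝔽₃^N` whose common difference has full support, read (middle, first, last).
2. **Directional cap sets are free diagonals** (`diagPow_restrictsTo_unitTensor_of_dirCapFree`):
   if `A ⊂ 𝔽₃^N` has no progression `x, x + d, x + 2d` with `d ∈ {0,1}^N ∖ 0`, the translation
   words `(x, x + 2·𝟙, x + 𝟙)`, `x ∈ A`, are an induced matching in `supp(D^{⊠N})`, so
   `D^{⊠N} ≥ ⟨|A|⟩` by zeroing out.  (The census diagonals `2, 6, 14, 36` at `N = 1, …, 4` are of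
   this form; exhaustive search at this node finds these to be the largest directional cap sets for
   `N ≤ 4`, and `14` to be the largest free diagonal inside `supp(D^{⊠3})` of any form — data, not
   claimed in Lean.)
3. **The cap-set lift** (`dirCapFree_preimage`, `card_preimage`, `cwPow_restrictsTo_unitTensor_of_cap`):
   for the pair-sum projection `π : 𝔽₃^N → 𝔽₃^k`, `(π x)_i = x_i + x_{i+k}` (`k ≤ N ≤ 2k`), and a cap
   set `Λ ⊂ 𝔽₃^k`, the preimage `π⁻¹(Λ)` is a directional cap set of size `3^{N−k}·|Λ|` (a
   `{0,1}`-vector with zero block sums is zero, blocks having at most two coordinates).  Hence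
   **`Q_ℂ(cw₂^{⊠2k}) ≥ 3^k · r₃(𝔽₃^k)`** and **`Q_ℂ(cw₂^{⊠(2k−1)}) ≥ 3^{k−1} · r₃(𝔽₃^k)`**.
4. **Floors**: the explicit caps (`r₃(𝔽₃^3) = 9`, `r₃(𝔽₃^4) = 20`, `r₃(𝔽₃^5) = 45`) and the
   resulting floors `Q_ℂ(cw₂^{⊠N}) ≥ 243, 540, 1620, 3645, 10935` at `N = 6, …, 10` (previously
   `216, 504, 1296, 3024, 7776` from products of `2, 6, 14`) are in the companion file
   `OutsiderSandwichCapSetFloors`.  The rate of the lift, `√(3 · r₃^{1/k}) ≥ √(3 · 2.2202) = 2.58`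
   per coordinate, is below the true rate `Q̃_ℂ(cw₂) = 3` (the support of `D` is tight with uniform
   marginals): these are finite-`N` census statements with no bearing on the exponential rates in
   `LaserTangency` / `LaserMergeOptimal`.

Honest tag: WEAKER·INSTRUMENT (finite floors + a structural dictionary progressions/cap sets ↔
free diagonals of `cw₂`-powers).

References.  M. Christandl, P. Vrana, J. Zuiddam, *Universal points in the asymptotic spectrum of
tensors*, J. Amer. Math. Soc. 36 (2023), §2.1 (subrank, zeroing out, tight supports)
[ChristandlVranaZuiddam2021]; V. Strassen, J. reine angew. Math. 413 (1991), §6 [Strassen1991];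
J. S. Ellenberg, D. Gijswijt, Ann. Math. 185 (2017) [EllenbergGijswijt2017]; J. Blasiak, T. Church,
H. Cohn, J. Grochow, E. Naslund, W. Sawin, C. Umans, Discrete Analysis 2017:3 (tricoloured sum-free
sets) [BlasiakChurchCohnGrochowNaslundSawinUmans2017]; R. Kleinberg, W. Sawin, D. Speyer, Discrete
Analysis 2018:12 [KleinbergSawinSpeyer2018]; J. M. Landsberg, *Geometry and Complexity Theory*, CUP
2017, §3.4.9 [LandsbergGCT2017].
-/

set_option linter.dupNamespace false

namespace Summit.MatrixMultiplication.MatrixMultiplication.Theorems.OutsiderSandwichCapSetLift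

open Literature.Computability.AlgebraicComplexity
open Literature.Barriers.MatrixMultiplication
open Summit.MatrixMultiplication.MatrixMultiplication.Theorems.OutsiderSandwichCwCubeSubrank
  (kroneckerPow_diag_eq_ite cwTwo_restrictsTo_diag)

/-! ## 1. The support of `D^{⊠N}` in arithmetic-progression normal form -/

/-- One letter: `a, b, c ∈ 𝔽₃` are pairwise distinct iff `(b, a, c) = (a − e, a, a + e)` is an
arithmetic progression with step `e ≠ 0` (middle letter first). [folklore] -/
theorem distinct_iff_exists_step (a b c : Fin 3) :
    (a ≠ b ∧ b ≠ c ∧ a ≠ c) ↔ ∃ e : Fin 3, e ≠ 0 ∧ b = a - e ∧ c = a + e := by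
  revert a b c; decide

/-- **`D` is the cap-set tensor minus the unit tensor**: in `𝔽₃`, `a + b + c = 0` iff the three
letters are all equal or pairwise distinct, so `D = 𝟙[a + b + c = 0] − 𝟙[a = b = c]` (and
`cw₂ ≅ D` over `ℂ`, `OutsiderSandwichCwCubeSubrank.cwTwo_restrictsTo_diag`).
[folklore; cite: BlasiakChurchCohnGrochowNaslundSawinUmans2017, §4] -/
theorem diag_eq_lineIndicator_sub_unit {D : Fin 3 → Fin 3 → Fin 3 → ℂ}
    (hD : ∀ a b c, D a b c = if a ≠ b ∧ b ≠ c ∧ a ≠ c then 1 else 0) (a b c : Fin 3) :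
    D a b c = (if a + b + c = 0 then 1 else 0) - (if a = b ∧ b = c then 1 else 0) := by
  have key : ∀ a b c : Fin 3, ((a ≠ b ∧ b ≠ c ∧ a ≠ c) ↔ (a + b + c = 0 ∧ ¬(a = b ∧ b = c))) ∧
      ((a = b ∧ b = c) → a + b + c = 0) := by decide
  obtain ⟨k1, k2⟩ := key a b c
  rw [hD]
  by_cases he : a = b ∧ b = c
  · rw [if_pos (k2 he), if_pos he, if_neg (fun h => (k1.1 h).2 he), sub_self]
  · by_cases h0 : a + b + c = 0
    · rw [if_pos (k1.2 ⟨h0, he⟩), if_pos h0, if_neg he, sub_zero]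
    · rw [if_neg (fun h => h0 (k1.1 h).1), if_neg h0, if_neg he, sub_zero]

/-- **AP normal form of the support of `D^{⊠N}`.**  The support of `D^{⊠N}` is the set of triples
`(x, x − d, x + d)` with `x ∈ 𝔽₃^N` and a common difference `d ∈ {1,2}^N` of FULL support: the
non-degenerate three-term arithmetic progressions of `𝔽₃^N` whose direction has no zero
coordinate, read (middle, first, last).  Over `ℂ`, `cw₂ ≅ D`, so this is the support of the
Coppersmith–Winograd power `cw₂^{⊠N}` in the diagonalising basis. [new; folklore dictionary] -/
theorem kroneckerPow_diag_ne_zero_iff {D : Fin 3 → Fin 3 → Fin 3 → ℂ}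
    (hD : ∀ a b c, D a b c = if a ≠ b ∧ b ≠ c ∧ a ≠ c then 1 else 0) (N : ℕ)
    (a b c : Fin N → Fin 3) :
    kroneckerPow D N a b c ≠ 0 ↔
      ∃ d : Fin N → Fin 3, (∀ m, d m ≠ 0) ∧ b = a - d ∧ c = a + d := by
  rw [kroneckerPow_diag_eq_ite hD]
  constructor
  · intro h
    have hm : ∀ m, a m ≠ b m ∧ b m ≠ c m ∧ a m ≠ c m := by
      by_contra hc
      exact h (if_neg hc)
    choose d hd using fun m => (distinct_iff_exists_step (a m) (b m) (c m)).1 (hm m)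
    exact ⟨d, fun m => (hd m).1, funext fun m => (hd m).2.1, funext fun m => (hd m).2.2⟩
  · rintro ⟨d, hd0, rfl, rfl⟩
    rw [if_pos (fun m => (distinct_iff_exists_step (a m) ((a - d) m) ((a + d) m)).2
      ⟨d m, hd0 m, rfl, rfl⟩)]
    exact one_ne_zero

/-! ## 2. Directional cap sets are free diagonals of `D^{⊠N}` -/

/-- One letter of the translation words `x ↦ (x, x + 2, x + 1)`: the letters `x`, `y + 2`, `z + 1`
are pairwise distinct iff `(x, z, y) = (x, x + t, x + 2t)` with `t ∈ {0, 1}`. [new] -/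
theorem step_of_letters (x y z : Fin 3) (h : x ≠ y + 2 ∧ y + 2 ≠ z + 1 ∧ x ≠ z + 1) :
    ∃ t : Fin 3, (t = 0 ∨ t = 1) ∧ z = x + t ∧ y = x + t + t := by
  revert x y z; decide

/-- The diagonal letters `x, x + 2, x + 1` are pairwise distinct. [folklore] -/
theorem letters_distinct (x : Fin 3) : x ≠ x + 2 ∧ x + 2 ≠ x + 1 ∧ x ≠ x + 1 := by
  revert x; decide

/-- **Directional cap sets are free diagonals** (word form).  Call `A ⊂ 𝔽₃^N` a *directional cap
set* if it contains no three-term progression `x, x + d, x + 2d` with `d ∈ {0,1}^N ∖ 0`.  For an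
injective word list `w` whose image is a directional cap set, the word triples
`(w i, w i + 2·𝟙, w i + 𝟙)` form an induced (free) diagonal in `supp(D^{⊠N})`, so
`D^{⊠N} ≥ ⟨s⟩` by zeroing out. [new; cite: ChristandlVranaZuiddam2021, §2.1] -/
theorem diagPow_restrictsTo_unitTensor_of_words {D : Fin 3 → Fin 3 → Fin 3 → ℂ}
    (hD : ∀ a b c, D a b c = if a ≠ b ∧ b ≠ c ∧ a ≠ c then 1 else 0) {N s : ℕ}
    (w : Fin s → Fin N → Fin 3) (hw : Function.Injective w)
    (hfree : ∀ i j l : Fin s, ∀ d : Fin N → Fin 3, (∀ m, d m = 0 ∨ d m = 1) →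
      w j = w i + d → w l = w i + d + d → d = 0) :
    TensorRestrictsTo (kroneckerPow D N) (unitTensor ℂ s) := by
  classical
  have key : unitTensor ℂ s =
      fun a b c => kroneckerPow D N (w a) (fun m => w b m + 2) (fun m => w c m + 1) := by
    funext a b c
    rw [kroneckerPow_diag_eq_ite hD, unitTensor_apply]
    by_cases hd : a = b ∧ b = c
    · obtain ⟨rfl, rfl⟩ := hd
      rw [if_pos ⟨rfl, rfl⟩, if_pos (fun m => letters_distinct (w a m))]
    · rw [if_neg hd, if_neg]
      intro hm
      apply hd
      choose t ht01 htz hty using fun m => step_of_letters (w a m) (w b m) (w c m) (hm m)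
      have h0 : t = 0 := hfree a c b t ht01 (funext htz) (funext hty)
      have hca : w c = w a := by
        funext m
        rw [htz m, h0]
        simp
      have hba : w b = w a := by
        funext m
        rw [hty m, h0]
        simp
      exact ⟨(hw hba).symm, (hw hba).trans (hw hca).symm⟩
  rw [key]
  exact tensorRestrictsTo_precomp _ _ _ _

/-- **Directional cap sets are free diagonals** (set form): if `A ⊂ 𝔽₃^N` contains no progression
`x, x + d, x + 2d` with `d ∈ {0,1}^N ∖ 0`, then `D^{⊠N} ≥ ⟨|A|⟩`. [new; cite:
ChristandlVranaZuiddam2021, §2.1] -/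
theorem diagPow_restrictsTo_unitTensor_of_dirCapFree {D : Fin 3 → Fin 3 → Fin 3 → ℂ}
    (hD : ∀ a b c, D a b c = if a ≠ b ∧ b ≠ c ∧ a ≠ c then 1 else 0) {N : ℕ}
    (A : Finset (Fin N → Fin 3))
    (hA : ∀ x ∈ A, ∀ d : Fin N → Fin 3, (∀ m, d m = 0 ∨ d m = 1) →
      x + d ∈ A → x + d + d ∈ A → d = 0) :
    TensorRestrictsTo (kroneckerPow D N) (unitTensor ℂ A.card) := by
  classical
  refine diagPow_restrictsTo_unitTensor_of_words hD (fun i => ((A.equivFin.symm i : A) : Fin N → Fin 3))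
    (fun i j hij => A.equivFin.symm.injective (Subtype.ext hij)) ?_
  intro i j l d hd hj hl
  exact hA _ (A.equivFin.symm i).2 d hd (hj ▸ (A.equivFin.symm j).2) (hl ▸ (A.equivFin.symm l).2)

/-! ## 3. The cap-set lift -/

/-- **Cap-set lift (abstract form).**  Let `π : 𝔽₃^N → 𝔽₃^k` be additive and such that no
non-zero `{0,1}`-vector lies in its kernel, and let `Λ ⊂ 𝔽₃^k` be a cap set (no three-term
progression).  Then `π⁻¹(Λ)` is a directional cap set. [new] -/
theorem dirCapFree_preimage {N k : ℕ} (π : (Fin N → Fin 3) → (Fin k → Fin 3))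
    (hadd : ∀ x y, π (x + y) = π x + π y)
    (hker : ∀ d : Fin N → Fin 3, (∀ m, d m = 0 ∨ d m = 1) → π d = 0 → d = 0)
    (Λ : Finset (Fin k → Fin 3))
    (hΛ : ∀ p ∈ Λ, ∀ δ : Fin k → Fin 3, p + δ ∈ Λ → p + δ + δ ∈ Λ → δ = 0) :
    ∀ x ∈ (Finset.univ.filter fun x => π x ∈ Λ), ∀ d : Fin N → Fin 3,
      (∀ m, d m = 0 ∨ d m = 1) → x + d ∈ (Finset.univ.filter fun x => π x ∈ Λ) →
        x + d + d ∈ (Finset.univ.filter fun x => π x ∈ Λ) → d = 0 := by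
  intro x hx d hd hxd hxdd
  simp only [Finset.mem_filter, Finset.mem_univ, true_and] at hx hxd hxdd
  rw [hadd] at hxd
  rw [hadd, hadd] at hxdd
  exact hker d hd (hΛ _ hx _ hxd hxdd)

/-- **Cap-set lift (tensor form)**: `D^{⊠N} ≥ ⟨|π⁻¹(Λ)|⟩`. [new; cite:
ChristandlVranaZuiddam2021, §2.1] -/
theorem diagPow_restrictsTo_unitTensor_preimage {D : Fin 3 → Fin 3 → Fin 3 → ℂ}
    (hD : ∀ a b c, D a b c = if a ≠ b ∧ b ≠ c ∧ a ≠ c then 1 else 0) {N k : ℕ}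
    (π : (Fin N → Fin 3) → (Fin k → Fin 3)) (hadd : ∀ x y, π (x + y) = π x + π y)
    (hker : ∀ d : Fin N → Fin 3, (∀ m, d m = 0 ∨ d m = 1) → π d = 0 → d = 0)
    (Λ : Finset (Fin k → Fin 3))
    (hΛ : ∀ p ∈ Λ, ∀ δ : Fin k → Fin 3, p + δ ∈ Λ → p + δ + δ ∈ Λ → δ = 0) :
    TensorRestrictsTo (kroneckerPow D N)
      (unitTensor ℂ (Finset.univ.filter fun x => π x ∈ Λ).card) :=
  diagPow_restrictsTo_unitTensor_of_dirCapFree hD _ (dirCapFree_preimage π hadd hker Λ hΛ)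

/-- Fibres of an additive surjection `π : 𝔽₃^N → 𝔽₃^k` all have size `3^N / 3^k`. [folklore] -/
theorem card_fibre_mul {N k : ℕ} (π : (Fin N → Fin 3) → (Fin k → Fin 3))
    (hadd : ∀ x y, π (x + y) = π x + π y) (hsurj : Function.Surjective π) (p : Fin k → Fin 3) :
    (Finset.univ.filter fun x => π x = p).card * 3 ^ k = 3 ^ N := by
  classical
  have hfib : ∀ q : Fin k → Fin 3,
      (Finset.univ.filter fun x => π x = p).card = (Finset.univ.filter fun x => π x = q).card := by
    intro q
    obtain ⟨x₀, hx₀⟩ := hsurj (q - p)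
    refine Finset.card_equiv (Equiv.addRight x₀) fun x => ?_
    simp only [Finset.mem_filter, Finset.mem_univ, true_and, Equiv.coe_addRight, hadd, hx₀]
    constructor
    · rintro rfl
      abel
    · intro h
      have := congrArg (· - (q - p)) h
      simpa using this
  have htot : (Finset.univ : Finset (Fin N → Fin 3)).card =
      ∑ q : Fin k → Fin 3, (Finset.univ.filter fun x => π x = q).card :=
    Finset.card_eq_sum_card_fiberwise fun x _ => Finset.mem_univ (π x)
  rw [Finset.card_univ, Fintype.card_fun, Fintype.card_fin, Fintype.card_fin] at htot
  rw [htot, Finset.sum_congr rfl fun q _ => (hfib q).symm, Finset.sum_const, smul_eq_mul,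
    Finset.card_univ, Fintype.card_fun, Fintype.card_fin, Fintype.card_fin, mul_comm]

/-- **Size of the lift**: `|π⁻¹(Λ)| = |Λ| · 3^{N−k}` for an additive surjection `π`. [folklore] -/
theorem card_preimage {N k : ℕ} (π : (Fin N → Fin 3) → (Fin k → Fin 3))
    (hadd : ∀ x y, π (x + y) = π x + π y) (hsurj : Function.Surjective π) (hk : k ≤ N)
    (Λ : Finset (Fin k → Fin 3)) :
    (Finset.univ.filter fun x => π x ∈ Λ).card = Λ.card * 3 ^ (N - k) := by
  classical
  have hsplit : (Finset.univ.filter fun x => π x ∈ Λ).card =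
      ∑ p ∈ Λ, ((Finset.univ.filter fun x => π x ∈ Λ).filter fun x => π x = p).card :=
    Finset.card_eq_sum_card_fiberwise fun x hx => (Finset.mem_filter.1 hx).2
  have hfib : ∀ p ∈ Λ, ((Finset.univ.filter fun x => π x ∈ Λ).filter fun x => π x = p) =
      Finset.univ.filter fun x => π x = p := by
    intro p hp
    ext x
    simp only [Finset.mem_filter, Finset.mem_univ, true_and]
    exact ⟨fun h => h.2, fun h => ⟨h ▸ hp, h⟩⟩
  have hpow : (3 : ℕ) ^ N = 3 ^ (N - k) * 3 ^ k := (pow_sub_mul_pow (3 : ℕ) hk).symm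
  apply Nat.eq_of_mul_eq_mul_right (pow_pos (by norm_num : (0 : ℕ) < 3) k)
  rw [hsplit, Finset.sum_congr rfl fun p hp => congrArg Finset.card (hfib p hp), Finset.sum_mul]
  simp_rw [card_fibre_mul π hadd hsurj, hpow]
  rw [Finset.sum_const, smul_eq_mul, mul_assoc]

/-- Cap sets in the pair form "no two points of `Λ` have their third collinear point in `Λ`"
contain no three-term progression (`p + 2δ = −(p + (p + δ))` in characteristic `3`). [folklore] -/
theorem capFree_of_pairs {k : ℕ} (Λ : Finset (Fin k → Fin 3))
    (h : ∀ p ∈ Λ, ∀ q ∈ Λ, p ≠ q → -(p + q) ∉ Λ) :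
    ∀ p ∈ Λ, ∀ δ : Fin k → Fin 3, p + δ ∈ Λ → p + δ + δ ∈ Λ → δ = 0 := by
  intro p hp δ h1 h2
  by_contra hδ
  have hne : p ≠ p + δ := fun he => hδ (left_eq_add.mp he)
  have key : ∀ x t : Fin 3, -(x + (x + t)) = x + t + t := by decide
  have h3 : -(p + (p + δ)) = p + δ + δ := funext fun i => key (p i) (δ i)
  exact h p hp (p + δ) h1 hne (h3 ▸ h2)

/-! ## 4. The pair-sum projection and the lift along `cw₂ ≥ D` -/

/-- One letter of the kernel condition: two bits with zero sum in `𝔽₃` are both zero. [folklore] -/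
theorem bits_eq_zero (a b : Fin 3) (ha : a = 0 ∨ a = 1) (hb : b = 0 ∨ b = 1) (h : a + b = 0) :
    a = 0 ∧ b = 0 := by
  revert a b; decide

/-- The **pair-sum projection** `π : 𝔽₃^N → 𝔽₃^k`, `k ≤ N ≤ 2k`, `(π x)_i = x_i + x_{i+k}` (the second
summand absent when `i + k ≥ N`), given as a schema `hπ`: it is additive. [folklore] -/
theorem pairSum_add {N k : ℕ} (hk : k ≤ N) (π : (Fin N → Fin 3) → (Fin k → Fin 3))
    (hπ : ∀ x i, π x i = x (Fin.castLE hk i) +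
      if h : (i : ℕ) + k < N then x ⟨(i : ℕ) + k, h⟩ else 0)
    (x y : Fin N → Fin 3) : π (x + y) = π x + π y := by
  funext i
  rw [Pi.add_apply, hπ, hπ, hπ]
  split_ifs with h
  · simp only [Pi.add_apply]
    abel
  · simp only [Pi.add_apply, add_zero]

/-- The pair-sum projection kills no non-zero `{0,1}`-vector (each block has at most two
coordinates, and `1`, `1 + 1 ≠ 0` in `𝔽₃`). [new] -/
theorem pairSum_ker {N k : ℕ} (hk : k ≤ N) (hN : N ≤ 2 * k)
    (π : (Fin N → Fin 3) → (Fin k → Fin 3))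
    (hπ : ∀ x i, π x i = x (Fin.castLE hk i) +
      if h : (i : ℕ) + k < N then x ⟨(i : ℕ) + k, h⟩ else 0)
    (d : Fin N → Fin 3) (hd : ∀ m, d m = 0 ∨ d m = 1) (h0 : π d = 0) : d = 0 := by
  funext m
  rw [Pi.zero_apply]
  by_cases hm : (m : ℕ) < k
  · have hi := congrFun h0 ⟨m, hm⟩
    rw [hπ, Pi.zero_apply] at hi
    have hc : Fin.castLE hk ⟨m, hm⟩ = m := Fin.ext rfl
    rw [hc] at hi
    by_cases h : (m : ℕ) + k < N
    · rw [dif_pos h] at hi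
      exact (bits_eq_zero _ _ (hd m) (hd _) hi).1
    · rw [dif_neg h, add_zero] at hi
      exact hi
  · have hmk : (m : ℕ) - k < k := by omega
    have hi := congrFun h0 ⟨(m : ℕ) - k, hmk⟩
    rw [hπ, Pi.zero_apply] at hi
    have h : ((⟨(m : ℕ) - k, hmk⟩ : Fin k) : ℕ) + k < N := by
      simp only
      omega
    rw [dif_pos h] at hi
    have hc : (⟨((⟨(m : ℕ) - k, hmk⟩ : Fin k) : ℕ) + k, h⟩ : Fin N) = m := Fin.ext (by simp; omega)
    rw [hc] at hi
    exact (bits_eq_zero _ _ (hd _) (hd m) hi).2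

/-- The pair-sum projection is surjective (`x = (p, 0)`). [folklore] -/
theorem pairSum_surjective {N k : ℕ} (hk : k ≤ N) (π : (Fin N → Fin 3) → (Fin k → Fin 3))
    (hπ : ∀ x i, π x i = x (Fin.castLE hk i) +
      if h : (i : ℕ) + k < N then x ⟨(i : ℕ) + k, h⟩ else 0) :
    Function.Surjective π := by
  intro p
  refine ⟨fun m => if h : (m : ℕ) < k then p ⟨m, h⟩ else 0, funext fun i => ?_⟩
  rw [hπ]
  show (if h : ((Fin.castLE hk i : Fin N) : ℕ) < k then p ⟨_, h⟩ else 0) +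
      (if h : (i : ℕ) + k < N then
        (if h' : ((⟨(i : ℕ) + k, h⟩ : Fin N) : ℕ) < k then p ⟨_, h'⟩ else 0) else 0) = p i
  have hi : ((Fin.castLE hk i : Fin N) : ℕ) < k := by simp [i.2]
  rw [dif_pos hi]
  have e1 : (⟨((Fin.castLE hk i : Fin N) : ℕ), hi⟩ : Fin k) = i := Fin.ext (by simp)
  rw [e1]
  split_ifs with h h'
  · exfalso
    simp at h'
  · exact add_zero _
  · exact add_zero _

/-- **The cap-set lift.**  For every cap set `Λ ⊂ 𝔽₃^k` (pair form: no two points of `Λ` have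
their third collinear point `−(p+q)` in `Λ`) and `k ≤ N ≤ 2k`:
**`cw₂^{⊠N} ≥ D^{⊠N} ≥ ⟨3^{N−k}·|Λ|⟩` over `ℂ`** — the preimage of `Λ` under the pair-sum
projection is a directional cap set of that size (§§2–3).  In particular
`Q_ℂ(cw₂^{⊠2k}) ≥ 3^k · r₃(𝔽₃^k)` and `Q_ℂ(cw₂^{⊠(2k−1)}) ≥ 3^{k−1} · r₃(𝔽₃^k)`, where `r₃(𝔽₃^k)` is
the size of the largest cap. [new; cite: ChristandlVranaZuiddam2021, §2.1;
EllenbergGijswijt2017]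
-/
theorem cwPow_restrictsTo_unitTensor_of_cap {N k : ℕ} (hk : k ≤ N) (hN : N ≤ 2 * k)
    (Λ : Finset (Fin k → Fin 3)) (hΛ : ∀ p ∈ Λ, ∀ q ∈ Λ, p ≠ q → -(p + q) ∉ Λ) :
    TensorRestrictsTo (kroneckerPow (cwTensor ℂ 2) N) (unitTensor ℂ (Λ.card * 3 ^ (N - k))) := by
  classical
  have hD : ∀ a b c : Fin 3, (fun a b c : Fin 3 => if a ≠ b ∧ b ≠ c ∧ a ≠ c then (1 : ℂ) else 0)
      a b c = if a ≠ b ∧ b ≠ c ∧ a ≠ c then 1 else 0 := fun _ _ _ => rfl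
  let π : (Fin N → Fin 3) → (Fin k → Fin 3) := fun x i =>
    x (Fin.castLE hk i) + if h : (i : ℕ) + k < N then x ⟨(i : ℕ) + k, h⟩ else 0
  have hπ : ∀ x i, π x i = x (Fin.castLE hk i) +
      if h : (i : ℕ) + k < N then x ⟨(i : ℕ) + k, h⟩ else 0 := fun _ _ => rfl
  rw [← card_preimage π (pairSum_add hk π hπ) (pairSum_surjective hk π hπ) hk Λ]
  exact ((cwTwo_restrictsTo_diag hD).kroneckerPow N).trans
    (diagPow_restrictsTo_unitTensor_preimage hD π (pairSum_add hk π hπ) (pairSum_ker hk hN π hπ) Λ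
      (capFree_of_pairs Λ hΛ))

/-- `n ≤ Q_ℂ(cw₂^{⊠N})` from a cap of size `c` in `𝔽₃^k` with `c · 3^{N−k} = n`. [new] -/
theorem le_subrank_cwPow_of_cap {N k n : ℕ} (hk : k ≤ N) (hN : N ≤ 2 * k)
    (Λ : Finset (Fin k → Fin 3)) (hΛ : ∀ p ∈ Λ, ∀ q ∈ Λ, p ≠ q → -(p + q) ∉ Λ)
    (hn : Λ.card * 3 ^ (N - k) = n) :
    TensorRestrictsTo (kroneckerPow (cwTensor ℂ 2) N) (unitTensor ℂ n) ∧
      n ≤ subrank ℂ (kroneckerPow (cwTensor ℂ 2) N) := by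
  have h := cwPow_restrictsTo_unitTensor_of_cap hk hN Λ hΛ
  rw [hn] at h
  exact ⟨h, le_subrank_of_restrictsTo h⟩

end Summit.MatrixMultiplication.MatrixMultiplication.Theorems.OutsiderSandwichCapSetLift
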